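import Summits.CriticalPhenomena.CardyFormulaZ2.Theses.CardyObliqueExplorer

/-!
# Birth skeleton `Lines/birth.lean` (BC3) for crux `CrossingHitDictionary` (stmt-CriticalPhenomena-7364)

Route `route-CriticalPhenomena-CardyObliqueExplorer`, sub-problem `CardyFormulaZ2`, crux (rank 5)
`Summit.CriticalPhenomena.CardyFormulaZ2.Theses.CardyObliqueExplorer.CrossingHitDictionary` — the
crossing / discrete-hitting dictionary on bond-`ℤ²`: for every conformal rectangle `R = (Ω; a, b, c, d)`
and every admissible square-lattice discretising family `E` of its chord `(Ω; a, c)`,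
`bondDomainCrossingProb R δ − P_{1/2}[the a→c-oriented medial exploration of E δ examines an edge with
an endpoint on (cd)_δ before any edge with an endpoint on (bc)_δ] → 0` as `δ → 0⁺`.

## The line: the classical "perturbed-rectangle sandwich", typed limit-free (three stubs)

The printed dictionaries (Smirnov 2001 §2 / Cor. 4; Werner 2007, Lecture 3 §7; Camia–Newman 2007
§§5–7) compare the hitting event with crossing events of slightly PERTURBED conformal rectangles and
then invoke continuity of the limit (Cardy's formula) in the marks. Here the continuity input is
replaced by a limit-free RSW statement, and the comparison is split into its combinatorial part and
its boundary-layer part: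

* `stub_markEquicontinuity` (S1, RSW one-arm at the marks; size L, known technique): the G02 crossing
  probabilities `bondDomainCrossingProb` are equicontinuous in the four marks, eventually in the mesh —
  moving the marks by `< ρ` (same carrier) changes the crossing probability by `< ε` for all small `δ`.
* `stub_dualitySandwich` (S2, planar duality of the medial exploration + arc-nesting bookkeeping +
  one-arm slack at the marks; size L): for every `ρ > 0` there are an INNER conformal rectangle `Rin`
  (arcs `(ab)`, `(cd)` shrunk away from the marks) and an OUTER one `Rout` (arcs enlarged past the
  marks), marks within `ρ`, with, for all small `δ`,
  `P[layerCrossing Rin δ] − ρ ≤ P[hit_E δ] ≤ P[layerCrossing Rout δ] + ρ`,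
  where `layerCrossing R' δ` is the BOUNDARY-LAYER-FREE crossing event of `R'`: an open path of `Ω_δ`
  from the `zdBoundary`-based discrete arc of `(a'b')` through INTERIOR sites (off `zdBoundary`) to a
  site adjacent in `Ω_δ` to the discrete arc of `(c'd')`. Mechanism: read from the `a`-end, the left
  vertices of the exploration form an open walk attached to the wired arc and the right faces a dual-open
  walk attached to the dual-wired arc; "hit `(cd)_δ` first" yields an interior open path from the
  `(ab)`-part of the wired arc to a neighbour of `(cd)_δ` (⊆ `layerCrossing Rout`), and "hit `(bc)_δ`
  strictly first" yields a dual walk from `a` to `(bc)` separating `(a⁺b⁺)` from `(c⁺d⁺)`, which no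
  interior open path can cross (so `layerCrossing Rin ⊆ hit`); the `ρ`-slack absorbs the configurations
  in which the interface enters the `o(1)`-neighbourhood of a mark before the decision (one-arm events at
  the marks) and the lattice conventions at tie sites.
* `stub_boundaryLayer` (S3, half-plane three-arm boundary-layer estimate; size L–XL; THE RISK of the crux
  lives here): for every conformal rectangle, `P[layerCrossing R' δ] − bondDomainCrossingProb R' δ → 0` —
  the boundary layer (crossings forced through boundary sites of the side arcs, clusters adjacent to the
  target arc without touching it, concave lattice corners missing from G02's `meshBoundary`) is invisible
  to crossing probabilities. For piecewise-smooth carriers this is the universal half-plane 3-arm exponent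
  `2 > 1` (Nolin 2008 Thm 23, §8.1 for bond-ℤ²); for general Jordan carriers it is exactly the crux's
  recorded "close approach without touching" risk (Camia–Newman 2007, Rem. 7.1).

ASSEMBLY `CrossingHitDictionary_of` (real proof, an `ε/3`-argument along the sandwich
`cross R ≈ cross Rin ≈ layer Rin ≲ hit ≲ layer Rout ≈ cross Rout ≈ cross R`): every stub is load-bearing.
No `sorry` outside the three `stub_*`. Each stub statement is the `Prop` named `Sig.stub_<name>` (so the
type of `stub_<name>` and the corresponding hypothesis of `CrossingHitDictionary_of` are the same constant,
verbatim); S1/S2/S3 below refer to them. The hitting event / probability `hitEvent`, `hitProb` are the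
crux's own sub-expressions verbatim (`crux_iff` below is the definitional check); `IsChordFamily` bundles
the crux's five-hypothesis frame verbatim.

Disproof used: none (no `Disproof.lean` on this crux at registration; `ledger crux ls` empty).
Negatives index: no refuted statement of the summit concerns the crossing/hitting dictionary.

BC3 record (2026-08-17, planner-skel-stmt-CriticalPhenomena-7364-0): `lean check --json` of this file rc 0,
errors [], sorries 3 = the three `stub_*` (none elsewhere). Probes (files `bc/stub_<name>_probe.lean`: this
file's definitions + `example : Sig.stub_<name> → <target> := by first | exact? | simpa [Sig.stub_<name>] |
(unfold Sig.stub_<name>; simpa) | aesop`, `maxHeartbeats 400000`) against the crux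
`Theses.CardyObliqueExplorer.CrossingHitDictionary` AND against the sub-problem statement
`_root_.CardyFormulaZ2`: all 6 FAIL (unsolved goals after the full battery; for `stub_boundaryLayer → crux`
the alternatives were also run separately: `simpa`/`unfold; simpa` fail, `aesop` exhausts, `exact?` times
out at 800000 heartbeats both before and after introducing the crux frame). No stub is cheaply the crux or
the summit.
-/

open scoped BigOperators Topology Classical MeasureTheory ProbabilityTheory
open Filter Set Function TopologicalSpace MeasureTheory
open Literature.Probability.RandomPlanarGeometry
open Literature.Probability.LatticeModels
open Literature.Probability.Percolation

namespace Summit.CriticalPhenomena.CardyFormulaZ2.Cruxes.CrossingHitDictionary.Birth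

/-! ### The crux's frame and hitting event, verbatim -/

/-- The common hypothesis block of every decl of route `CardyObliqueExplorer` (verbatim): `E` is an
admissible square-lattice discretising family of the chord `(Ω; a, c)` of `R` — canonical domain and
mesh, wired arc `→ (abc)`, dual-wired arc `→ (cda)` in Hausdorff distance, discrete marks `→ {a, c}`,
`IsZdAdmissible` for all small `δ`. (The fields of `LatticeModels.IsDiscretisation (R.chord 0 2) E`,
inlined as in the route file.) -/
structure IsChordFamily (R : ConformalRectangle) (E : ℝ → DiscreteDobrushin) : Prop where
  frame : ∀ δ, (E δ).Ω = R.carrier ∧ (E δ).δ = δ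
  arcA : Filter.Tendsto (fun δ => Metric.hausdorffEDist (E δ).arcA ((R.chord 0 2 (by decide)).arc 0))
    (nhdsWithin 0 (Set.Ioi 0)) (nhds 0)
  arcB : Filter.Tendsto (fun δ => Metric.hausdorffEDist (E δ).arcB ((R.chord 0 2 (by decide)).arc 1))
    (nhdsWithin 0 (Set.Ioi 0)) (nhds 0)
  marks : Filter.Tendsto (fun δ => Metric.hausdorffEDist
      (Literature.Probability.LatticeModels.medialPoint δ '' (E δ).zdABEdges) {R.pt 0, R.pt 2})
    (nhdsWithin 0 (Set.Ioi 0)) (nhds 0)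
  adm : ∀ᶠ δ in nhdsWithin (0:ℝ) (Set.Ioi 0), (E δ).IsZdAdmissible

/-- The exploration hitting event of the crux at mesh `δ` (verbatim sub-expression of
`CrossingHitDictionary` / `ExplorationHitCardy`): the `a→c`-oriented medial exploration of `E δ`
examines an edge with an endpoint on `zdDiscreteArc (R.arc 2) = (cd)_δ` before any edge with an
endpoint on `zdDiscreteArc (R.arc 1) = (bc)_δ`. -/
def hitEvent (R : ConformalRectangle) (E : ℝ → DiscreteDobrushin) (δ : ℝ) :
    Set (BondConfig (Site 2)) :=
  {cfg | let l := Literature.Probability.LatticeModels.medialExploration (E δ) cfg; let l' := (if (∀ e₀ ∈ l.head?, dist (Literature.Probability.LatticeModels.medialPoint δ e₀) (R.pt 0) ≤ dist (Literature.Probability.LatticeModels.medialPoint δ e₀) (R.pt 2)) then l else l.reverse); ∃ n : ℕ, ∃ e ∈ l'[n]?, (∃ v ∈ e, v ∈ (E δ).zdDiscreteArc (R.arc 2)) ∧ ∀ m < n, ∀ e' ∈ l'[m]?, ∀ v ∈ e', v ∉ (E δ).zdDiscreteArc (R.arc 1)}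

/-- The `P_{1/2}`-probability of the hitting event (verbatim sub-expression of the crux). -/
noncomputable def hitProb (R : ConformalRectangle) (E : ℝ → DiscreteDobrushin) (δ : ℝ) : ℝ :=
  (bondPercolation (zdGraph 2) half).real (hitEvent R E δ)

/-- Definitional check: the crux is the bundled statement `∀ R E, IsChordFamily R E →
(bondDomainCrossingProb R δ − hitProb R E δ → 0)`. -/
theorem crux_iff :
    Summit.CriticalPhenomena.CardyFormulaZ2.Theses.CardyObliqueExplorer.CrossingHitDictionary ↔
      ∀ (R : ConformalRectangle) (E : ℝ → DiscreteDobrushin), IsChordFamily R E →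
        Tendsto (fun δ => bondDomainCrossingProb R δ - hitProb R E δ) (𝓝[>] 0) (𝓝 0) :=
  ⟨fun h R E hf => h R E hf.frame hf.arcA hf.arcB hf.marks hf.adm,
    fun h R E hE hA hB hM hadm => h R E ⟨hE, hA, hB, hM, hadm⟩⟩

/-! ### The boundary-layer-free crossing event -/

/-- The Dobrushin datum carrying only the frame `(Ω, δ)` (empty arcs): `zdBoundary` and
`zdDiscreteArc` of a `DiscreteDobrushin` depend only on its domain and mesh (`zdBoundary_eq_frame`),
so this gives the square-lattice discrete boundary / discrete arcs of the frame itself. -/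
def frameDatum (Ω : Set ℂ) (δ : ℝ) : DiscreteDobrushin := ⟨Ω, δ, ∅, ∅⟩

/-- `zdBoundary` depends only on the frame. -/
theorem zdBoundary_eq_frame (D : DiscreteDobrushin) :
    D.zdBoundary = (frameDatum D.Ω D.δ).zdBoundary := by
  cases D; rfl

/-- `zdDiscreteArc` depends only on the frame. -/
theorem zdDiscreteArc_eq_frame (D : DiscreteDobrushin) (A' : Set ℂ) :
    D.zdDiscreteArc A' = (frameDatum D.Ω D.δ).zdDiscreteArc A' := by
  cases D; rfl

/-- The **boundary-layer-free crossing event** of the conformal rectangle `R'` at mesh `δ`: some site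
`x` of the (`zdBoundary`-based) discrete arc of `(a'b') = R'.arc 0` is joined, by a path of `Ω_δ` that
is open in `ω` and whose sites after `x` all lie OFF the discrete boundary `zdBoundary`, to a site `v`
which is `Ω_δ`-adjacent to a site `y` of the discrete arc of `(c'd') = R'.arc 2`. Compared with G02's
`discreteCrossing` (behind `bondDomainCrossingProb`): no boundary site may be used on the way, the
target arc need only be approached to within one edge, and the arcs are cut out of `zdBoundary`
(concave lattice corners included) rather than `meshBoundary`. -/
def layerCrossing (R' : ConformalRectangle) (δ : ℝ) : Set (BondConfig (Site 2)) :=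
  {ω | ∃ x ∈ (frameDatum R'.carrier δ).zdDiscreteArc (R'.arc 0),
    ∃ y ∈ (frameDatum R'.carrier δ).zdDiscreteArc (R'.arc 2), ∃ v : Site 2,
      (discreteDomainGraph R'.carrier δ).Adj v y ∧
        ∃ p : (openGraph ω ⊓ discreteDomainGraph R'.carrier δ).Walk x v,
          ∀ z ∈ p.support.tail, z ∉ (frameDatum R'.carrier δ).zdBoundary}

/-- The `P_{1/2}`-probability of the boundary-layer-free crossing event. -/
noncomputable def layerCrossingProb (R' : ConformalRectangle) (δ : ℝ) : ℝ :=
  (bondPercolation (zdGraph 2) half).real (layerCrossing R' δ)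

/-! ### Nested conformal rectangles -/

/-- `Rin` is nested INSIDE `R`: same carrier, its arcs `(a'b') ⊆ (ab)` and `(c'd') ⊆ (cd)` missing the
four marks of `R` (closed sub-arcs of the open arcs). -/
def InnerNested (R Rin : ConformalRectangle) : Prop :=
  Rin.carrier = R.carrier ∧ Rin.arc 0 ⊆ R.arc 0 ∧ Rin.arc 2 ⊆ R.arc 2 ∧
    R.pt 0 ∉ Rin.arc 0 ∧ R.pt 1 ∉ Rin.arc 0 ∧ R.pt 2 ∉ Rin.arc 2 ∧ R.pt 3 ∉ Rin.arc 2

/-- `Rout` is nested OUTSIDE `R`: same carrier, its arcs `(a'b') ⊇ (ab)` and `(c'd') ⊇ (cd)` extend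
strictly past the four marks of `R`. -/
def OuterNested (R Rout : ConformalRectangle) : Prop :=
  Rout.carrier = R.carrier ∧ R.arc 0 ⊆ Rout.arc 0 ∧ R.arc 2 ⊆ Rout.arc 2 ∧
    Rout.pt 0 ∉ R.arc 0 ∧ Rout.pt 1 ∉ R.arc 0 ∧ Rout.pt 2 ∉ R.arc 2 ∧ Rout.pt 3 ∉ R.arc 2

/-! ### The three statements of the line -/

/-- **S1 — equicontinuity of the bond-ℤ² crossing probabilities in the marks, eventually in the mesh
(RSW, size L).** For every conformal rectangle `R` and `ε > 0` there is `ρ > 0` such that every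
conformal rectangle `R'` with the same carrier and marks within `ρ` of those of `R` has
`|bondDomainCrossingProb R' δ − bondDomainCrossingProb R δ| < ε` for all small `δ > 0`. Why plausibly
true: the symmetric difference of the two crossing events forces an open (or dual) arm from the
`o_ρ(1)`-neighbourhood of a mark to macroscopic distance inside `Ω`, which RSW at `p = 1/2` blocks in
each dyadic annulus around the mark with probability bounded below (independently of the shape of the
Jordan boundary); with four marks in cyclic order and `ρ` small the perturbed rectangle has the same
orientation. Sources: Grimmett 1999 §11.7 (RSW on ℤ²); Werner 2007 L3; Nolin 2008 §4;
Schramm–Smirnov 2011 Lemma 5.1/6.1 (tree: `QuadCrossing.SchrammSmirnov2011_lemma_5_1_holds`,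
`QuadCrossing.continuity_of_lemma_5_1` — quad-continuity, a candidate engine). -/
def Sig.stub_markEquicontinuity : Prop :=
  ∀ (R : ConformalRectangle) (ε : ℝ), 0 < ε → ∃ ρ > (0:ℝ), ∀ R' : ConformalRectangle,
    R'.carrier = R.carrier → (∀ i, dist (R'.pt i) (R.pt i) < ρ) →
      ∀ᶠ δ in 𝓝[>] (0:ℝ), |bondDomainCrossingProb R' δ - bondDomainCrossingProb R δ| < ε

/-- **S2 — the duality sandwich (planar duality of the medial exploration, size L).** For every
conformal rectangle `R`, admissible discretising family `E` of its chord `(Ω; a, c)` and `ρ > 0` there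
are conformal rectangles `Rin` nested inside `R` and `Rout` nested outside `R`, with marks within `ρ`,
such that for all small `δ > 0`
`layerCrossingProb Rin δ − ρ ≤ hitProb R E δ ≤ layerCrossingProb Rout δ + ρ`.
Why plausibly true: read from the `a`-end, the left vertices of the exploration form an open walk
attached to the wired arc `(abc)_δ` and the right faces a dual-open walk attached to the dual-wired
arc; on `hit (cd)_δ first` the last arc-visit of the left walk starts an interior open path to a
neighbour of `(cd)_δ` — inside `layerCrossing Rout` once `δ` is small (Hausdorff convergence of the
arcs of `E`, monotonicity of `zdDiscreteArc` in the arc); on `hit (bc)_δ strictly first` the right dual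
walk runs from `a` to `(bc)` and separates `(a⁺b⁺)` from `(c⁺d⁺)`, so no interior open path realises
`layerCrossing Rin`. The `ρ`-slack pays for the interface entering the `o(1)`-neighbourhood of a mark
before the decision (one-arm at the marks, RSW) and for tie/degenerate lattice sites; `Rin`, `Rout`
exist by sliding the marks along the Jordan curve. Leans on `existsUnique_medialExploration` /
`isMedialExploration_medialExploration` (named facts). Sources: Smirnov 2001 §2; Werner 2007 L3 §7;
Camia–Newman 2007 §5; Grimmett 1999 §11.2 (planar duality on ℤ²). -/
def Sig.stub_dualitySandwich : Prop :=
  ∀ (R : ConformalRectangle) (E : ℝ → DiscreteDobrushin), IsChordFamily R E →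
    ∀ ρ > (0:ℝ), ∃ Rin Rout : ConformalRectangle,
      InnerNested R Rin ∧ OuterNested R Rout ∧
      (∀ i, dist (Rin.pt i) (R.pt i) < ρ) ∧ (∀ i, dist (Rout.pt i) (R.pt i) < ρ) ∧
      ∀ᶠ δ in 𝓝[>] (0:ℝ),
        layerCrossingProb Rin δ - ρ ≤ hitProb R E δ ∧ hitProb R E δ ≤ layerCrossingProb Rout δ + ρ

/-- **S3 — the boundary layer is invisible (half-plane three-arm estimate, size L–XL; carries the
crux's recorded risk).** For every conformal rectangle `R'`,
`layerCrossingProb R' δ − bondDomainCrossingProb R' δ → 0` as `δ → 0⁺`. The symmetric difference of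
`layerCrossing R'` and G02's `discreteCrossing` consists of configurations with a boundary site of a
side arc that is pivotal for the crossing (two open arms and one dual arm from a boundary point), or an
open cluster adjacent to the target arc without touching it (one open arm and two dual arms from a
boundary point), or a contact with the arc `(a'b')` only through concave lattice corners whose boundary
edges are closed; summed along the arcs these are `O(δ^{β₃⁺ − 1}) = O(δ)` for piecewise-smooth
carriers by the universal half-plane exponents `β₂⁺ = 1`, `β₃⁺ = 2` (Nolin 2008 Thm 23, §8.1 for
bond-ℤ²; tree: `LawlerSchrammWerner2002_halfPlane_threeArm` for site-𝕋). Why it might fail: for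
non-rectifiable / non-convex fractal Jordan arcs the three-arm summation "appears to break down"
(Camia–Newman 2007, Rem. 7.1) — exactly the crux's recorded failure mode, now isolated in an `E`-free
statement about free critical bond percolation. -/
def Sig.stub_boundaryLayer : Prop :=
  ∀ R' : ConformalRectangle,
    Tendsto (fun δ => layerCrossingProb R' δ - bondDomainCrossingProb R' δ) (𝓝[>] 0) (𝓝 0)

/-! ### Registered stubs (the ONLY sorries of this file) -/

/-- **stub_markEquicontinuity** (S1, size L; RSW one-arm at the marks). See `Sig.stub_markEquicontinuity`. -/
theorem stub_markEquicontinuity : Sig.stub_markEquicontinuity := by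
  sorry

/-- **stub_dualitySandwich** (S2, size L; planar duality of the medial exploration, nesting of the
discrete arcs, one-arm slack at the marks). See `Sig.stub_dualitySandwich`. -/
theorem stub_dualitySandwich : Sig.stub_dualitySandwich := by
  sorry

/-- **stub_boundaryLayer** (S3, size L–XL; half-plane three-arm boundary-layer estimate — the hardest
and riskiest stub). See `Sig.stub_boundaryLayer`. -/
theorem stub_boundaryLayer : Sig.stub_boundaryLayer := by
  sorry

/-! ### The composition: the three stubs imply the crux, by name (no `sorry`) -/

/-- **`CrossingHitDictionary` from the three stubs** — an `ε/3`-argument along the sandwich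
`cross R ≈ cross Rin ≈ layer Rin ≤ hit + ρ` and `hit ≤ layer Rout + ρ ≈ cross Rout + ρ ≈ cross R + ρ`:
S1 at `R` with `ε/3` gives the mark tolerance `ρ₁`; S2 with `ρ := min ρ₁ (ε/3)` gives `Rin`, `Rout`
(marks within `ρ₁`) and the eventual sandwich; S3 at `Rin` and `Rout` and S1 at `Rin` and `Rout` give
the four eventual `ε/3`-comparisons; on the intersection of the five eventual sets
`|bondDomainCrossingProb R δ − hitProb R E δ| < ε`. The conclusion is literally the route declaration. -/
theorem CrossingHitDictionary_of (h₁ : Sig.stub_markEquicontinuity)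
    (h₂ : Sig.stub_dualitySandwich) (h₃ : Sig.stub_boundaryLayer) :
    Summit.CriticalPhenomena.CardyFormulaZ2.Theses.CardyObliqueExplorer.CrossingHitDictionary := by
  intro R E hE hA hB hM hadm
  have hfam : IsChordFamily R E := ⟨hE, hA, hB, hM, hadm⟩
  show Tendsto (fun δ => bondDomainCrossingProb R δ - hitProb R E δ) (𝓝[>] 0) (𝓝 0)
  rw [Metric.tendsto_nhds]
  intro ε hε
  have hε3 : 0 < ε / 3 := by positivity
  -- S1 at `R`: the mark tolerance `ρ₁` for `ε/3`
  obtain ⟨ρ₁, hρ₁, H1⟩ := h₁ R (ε / 3) hε3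
  -- S2 with slack `min ρ₁ (ε/3)`: the inner and outer rectangles and the eventual sandwich
  obtain ⟨Rin, Rout, hin, hout, hdin, hdout, H2⟩ :=
    h₂ R E hfam (min ρ₁ (ε / 3)) (lt_min hρ₁ hε3)
  -- S1 at `Rin`, `Rout` (marks within `ρ₁`)
  have H1in := H1 Rin hin.1 fun i => lt_of_lt_of_le (hdin i) (min_le_left _ _)
  have H1out := H1 Rout hout.1 fun i => lt_of_lt_of_le (hdout i) (min_le_left _ _)
  -- S3 at `Rin`, `Rout`
  have H3in := Metric.tendsto_nhds.1 (h₃ Rin) (ε / 3) hε3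
  have H3out := Metric.tendsto_nhds.1 (h₃ Rout) (ε / 3) hε3
  have hmin : min ρ₁ (ε / 3) ≤ ε / 3 := min_le_right _ _
  filter_upwards [H1in, H1out, H2, H3in, H3out] with δ h1i h1o h2 h3i h3o
  rw [Real.dist_0_eq_abs] at h3i h3o ⊢
  rw [abs_lt] at h1i h1o h3i h3o ⊢
  obtain ⟨h2a, h2b⟩ := h2
  constructor <;> linarith

end Summit.CriticalPhenomena.CardyFormulaZ2.Cruxes.CrossingHitDictionary.Birth
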